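import Mathlib
import HarnessLib
import Summits.AtomisticToContinuum.Crystallization.Theorems.BrittleRungDescentSoftLayerPropagationCaseFSteps
import Summits.AtomisticToContinuum.Crystallization.Theorems.BrittleRungDescentSoftLayerPropagationCovering
import Summits.AtomisticToContinuum.Crystallization.Theorems.PricedLinkCensusSoftLayerPropagationStubBallPropagationNumerics

/-!
# Local layer propagation, FCC grain: the core around the nearest centre

Route `BrittleRungDescent`, support item `SoftLayerPropagation` (stmt-AtomisticToContinuum-9210),
helper file (η = 0, vocabulary of `FejesTothKissingTwelve.lean`: unit balls, contact distance `2`;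
uses `…CaseFSteps.lean`, `…Covering.lean`).

THE SETTING of the FCC case of the finite-ball statement.  `V` is a packing of unit balls with the
separation property of Hales's Lemma 2 (`hsep`: two centres coincide, touch, or are `≥ 2h₀ = 2.52`
apart); the origin is a centre whose shell is the FCC-arranged set `F`, and it is a NEAREST centre
to the point `c` (so `‖c‖ ≤ √2`: no room); every centre within `Rp` of `c` has an FCC- or
HCP-arranged shell (`hpat`); and (`hnohcp`, "no HCP mirror plane near `c`") every HCP-arranged
shell of a centre `y` within `Rp` of `c` has its mirror plane at distance `> D` from `c`
(`D < |⟪c − y, B n₀⟫|` for every presentation `B`).  Then: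

* `isArrangedIn_fcc_of_norm_sub_le` — a centre within `D` of `c` has an FCC shell;
* `kissingShell_eq_of_second_neighbour` — a centre `x = x′ + g` with `x′ ⊥ g` in `F` (a second
  neighbour of the origin across an octahedron) with an FCC shell is certified: the square corner
  `k − x; −g, −x′` (`k` a common neighbour of `x′, g`) lies in its shell and in `F`;
* `core_certified` — **every centre `x` within `19/10` of `c` is a lattice point
  (`x ∈ AddSubgroup.closure F`) with shell EXACTLY `F`**: `x` is the origin, a neighbour of it
  (FCC step), or a second neighbour reached through a neighbour `x′` which is FCC (two FCC steps)
  or HCP (far triple excluded by `hnohcp`: `far_level_excluded`).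

Radii: `4 ≤ Rp`, `19/10 ≤ D`.  All statements are elementary ([folklore]).
-/

noncomputable section

namespace Summit.AtomisticToContinuum.Crystallization.Theorems

open Literature.Geometry.DiscreteGeometry Literature.MathematicalPhysics.StatisticalMechanics
open RealInnerProductSpace


/-- A vector of squared norm `4` has norm `2`. [folklore] -/
theorem norm_eq_two_of_sq {x : EuclideanSpace ℝ (Fin 3)} (h : ‖x‖ ^ 2 = 4) : ‖x‖ = 2 := by
  have h' : ‖x‖ ^ 2 = 2 ^ 2 := by rw [h]; norm_num
  exact (pow_left_inj₀ (norm_nonneg _) zero_le_two two_ne_zero).1 h'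

/-! ### The far level is excluded near `c` -/

/-- **The far triple is too far.**  If `n` is a unit vector, `⟪−x′, n⟫ = 𝗁` (the origin side),
`⟪q, n⟫ = −𝗁`, `‖c‖ ≤ √2`, and the mirror plane through `x′` is at distance `> D ≥ 19/10` from `c`
(`D < |⟪c − x′, n⟫|`), then the centre `x′ + q` is NOT within `19/10` of `c`. [folklore] -/
theorem far_level_excluded {c x' q n : EuclideanSpace ℝ (Fin 3)} {D : ℝ} (hn : ‖n‖ = 1)
    (hlev : ⟪-x', n⟫ = layerSpacing) (hq : ⟪q, n⟫ = -layerSpacing) (hc : ‖c‖ ≤ Real.sqrt 2)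
    (hD : 19 / 10 ≤ D) (hfar : D < |⟪c - x', n⟫|) (hx : ‖(x' + q) - c‖ ≤ 19 / 10) : False := by
  have hl16 : (1.63 : ℝ) < layerSpacing := by linarith [layerSpacing_bounds.1]
  have hs2 : Real.sqrt 2 < 1.415 := by
    rw [show (1.415 : ℝ) = Real.sqrt (1.415 ^ 2) by rw [Real.sqrt_sq (by norm_num)]]
    exact Real.sqrt_lt_sqrt (by norm_num) (by norm_num)
  have hcn : -Real.sqrt 2 ≤ ⟪c, n⟫ := by
    have h1 := abs_real_inner_le_norm c n
    rw [hn, mul_one] at h1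
    have h2 := neg_abs_le ⟪c, n⟫
    linarith
  have hcx' : ⟪c - x', n⟫ = ⟪c, n⟫ + layerSpacing := by
    rw [inner_sub_left, ← hlev, inner_neg_left]; ring
  have hpos : D < ⟪c - x', n⟫ := by
    have : 0 < ⟪c - x', n⟫ := by rw [hcx']; linarith
    rwa [abs_of_pos this] at hfar
  have hcx : ⟪c - (x' + q), n⟫ = ⟪c - x', n⟫ + layerSpacing := by
    rw [show c - (x' + q) = (c - x') - q by abel, inner_sub_left, hq]; ring
  have hbd : ⟪c - (x' + q), n⟫ ≤ 19 / 10 := by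
    have h1 := abs_real_inner_le_norm (c - (x' + q)) n
    rw [hn, mul_one, norm_sub_rev] at h1
    linarith [le_abs_self ⟪c - (x' + q), n⟫]
  linarith

/-! ### A second neighbour across an octahedron is certified by a square corner -/

section Second

variable {V : Set (EuclideanSpace ℝ (Fin 3))} {F : Set (EuclideanSpace ℝ (Fin 3))}

/-- Two points of an FCC-arranged set summing to a vector of squared norm in `[6.35, 12)` are
orthogonal (their inner product is one of `4, 2, 0, −2, −4`). [folklore] -/
theorem inner_eq_zero_of_norm_add_sq (hF : IsArrangedIn F fccKissingPattern) {x' g : EuclideanSpace ℝ (Fin 3)}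
    (hx'F : x' ∈ F) (hgF : g ∈ F) (hlo : 6.35 ≤ ‖x' + g‖ ^ 2) (hhi : ‖x' + g‖ ^ 2 < 12) : ⟪x', g⟫ = 0 := by
  have hxsq : ‖x' + g‖ ^ 2 = 8 + 2 * ⟪x', g⟫ := by
    rw [norm_add_sq_real, norm_eq_two_of_isArrangedIn_fcc hF hx'F, norm_eq_two_of_isArrangedIn_fcc hF hgF]; ring
  rcases inner_cases_of_isArrangedIn_fcc hF hx'F hgF with h5 | h5 | h5 | h5 | h5
  · rw [h5] at hxsq; linarith
  · rw [h5] at hxsq; linarith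
  · exact h5
  · rw [h5] at hxsq; linarith
  · rw [h5] at hxsq; linarith

/-- **A second neighbour across an octahedron is certified.**  Let the shell of the origin be the
FCC-arranged `F` (so `F ⊆ V`), let `x′, g ∈ F` be orthogonal and `x = x′ + g ∈ V` have an
FCC-arranged shell.  Then the shell of `x` is `F`: with `k ∈ F` a common neighbour of `x′, g`, the
square corner `k − x; −g, −x′` lies in the shell of `x` and in `F`. [folklore] -/
theorem kissingShell_eq_of_second_neighbour (hF : IsArrangedIn F fccKissingPattern)
    (h0 : kissingShell V 0 = F) {x' g : EuclideanSpace ℝ (Fin 3)} (hx'F : x' ∈ F) (hgF : g ∈ F)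
    (horth : ⟪x', g⟫ = 0)
    (hxfcc : IsArrangedIn (kissingShell V (x' + g)) fccKissingPattern) : kissingShell V (x' + g) = F := by
  have memV : ∀ {f}, f ∈ F → f ∈ V := fun {f} hf => by
    have : f ∈ kissingShell V 0 := h0 ▸ hf
    simpa using this.1
  have hg2 : ‖g‖ = 2 := norm_eq_two_of_isArrangedIn_fcc hF hgF
  have hx'2 : ‖x'‖ = 2 := norm_eq_two_of_isArrangedIn_fcc hF hx'F
  obtain ⟨k, hkF, hkx', hkg⟩ := exists_common_of_isArrangedIn_fcc hF hx'F hgF horth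
  have hk2 : ‖k‖ = 2 := norm_eq_two_of_isArrangedIn_fcc hF hkF
  have hkx'i : ⟪k, x'⟫ = 2 := by
    have e : ‖k - x'‖ ^ 2 = 4 := by rw [← dist_eq_norm, hkx']; norm_num
    rw [norm_sub_sq_real, hk2, hx'2] at e; linarith
  have hkgi : ⟪k, g⟫ = 2 := by
    have e : ‖k - g‖ ^ 2 = 4 := by rw [← dist_eq_norm, hkg]; norm_num
    rw [norm_sub_sq_real, hk2, hg2] at e; linarith
  have hkxn : ‖k - (x' + g)‖ = 2 := by
    apply norm_eq_two_of_sq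
    rw [show k - (x' + g) = k - x' - g by abel, norm_sub_sq_real, norm_sub_sq_real, hk2, hx'2, hg2,
      inner_sub_left, hkx'i, hkgi, horth]
    norm_num
  -- the corner, in the shell of `x` …
  have m1 : k - (x' + g) ∈ kissingShell V (x' + g) := ⟨by rw [add_sub_cancel]; exact memV hkF, hkxn⟩
  have m2 : -g ∈ kissingShell V (x' + g) := ⟨by rw [add_neg_cancel_right]; exact memV hx'F, by rw [norm_neg, hg2]⟩
  have m3 : -x' ∈ kissingShell V (x' + g) :=
    ⟨by rw [show x' + g + -x' = g by abel]; exact memV hgF, by rw [norm_neg, hx'2]⟩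
  -- … and in `F`
  have n1 : k - (x' + g) ∈ F := by
    rw [show k - (x' + g) = (k - x') - g by abel]
    refine sub_mem_of_isArrangedIn_fcc hF (sub_mem_of_isArrangedIn_fcc hF hkF hx'F hkx') hgF ?_
    rw [dist_eq_norm, show k - x' - g = k - (x' + g) by abel, hkxn]
  have n2 : -g ∈ F := neg_mem_of_isArrangedIn_fcc hF hgF
  have n3 : -x' ∈ F := neg_mem_of_isArrangedIn_fcc hF hx'F
  have d12 : dist (k - (x' + g)) (-g) = 2 := by
    rw [dist_eq_norm, show k - (x' + g) - -g = k - x' by abel, ← dist_eq_norm, hkx']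
  have d13 : dist (k - (x' + g)) (-x') = 2 := by
    rw [dist_eq_norm, show k - (x' + g) - -x' = k - g by abel, ← dist_eq_norm, hkg]
  have d23 : dist (-g) (-x') ^ 2 = 8 := by
    rw [dist_eq_norm, show -g - -x' = x' - g by abel, norm_sub_sq_real, hx'2, hg2, horth]; norm_num
  exact eq_of_isArrangedIn_fcc_of_corner hxfcc hF m1 m2 m3 n1 n2 n3 d12 d13 d23

end Second

/-! ### The core -/

section Core

variable {V : Set (EuclideanSpace ℝ (Fin 3))} {F : Set (EuclideanSpace ℝ (Fin 3))}
  {c : EuclideanSpace ℝ (Fin 3)} {Rp D : ℝ}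

/-- **No HCP mirror plane near `c` ⇒ centres near `c` are FCC**: if every HCP presentation of a
shell within `Rp` of `c` has `D < |⟪c − y, B n₀⟫|`, a centre `y` with `‖y − c‖ ≤ D` (and `< Rp`)
has an FCC-arranged shell (`|⟪c − y, B n₀⟫| ≤ ‖c − y‖`). [folklore] -/
theorem isArrangedIn_fcc_of_norm_sub_le
    (hpat : ∀ y ∈ V, ‖y - c‖ < Rp →
      IsArrangedIn (kissingShell V y) fccKissingPattern ∨ IsArrangedIn (kissingShell V y) hcpKissingPattern)
    (hnohcp : ∀ y ∈ V, ‖y - c‖ < Rp → ∀ B : EuclideanSpace ℝ (Fin 3) →ₗᵢ[ℝ] EuclideanSpace ℝ (Fin 3),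
      kissingShell V y = Set.range (fun i => B (hcpRef i)) →
      D < |⟪c - y, B ((Real.sqrt 3)⁻¹ • intVec ![1, 1, 1])⟫|)
    {y : EuclideanSpace ℝ (Fin 3)} (hy : y ∈ V) (hyR : ‖y - c‖ < Rp) (hyD : ‖y - c‖ ≤ D) :
    IsArrangedIn (kissingShell V y) fccKissingPattern := by
  rcases hpat y hy hyR with h | h
  · exact h
  · exfalso
    obtain ⟨B, hB⟩ := isArrangedIn_hcp_iff_range.1 h
    have h1 := hnohcp y hy hyR B hB
    have h2 : |⟪c - y, B ((Real.sqrt 3)⁻¹ • intVec ![1, 1, 1])⟫| ≤ ‖c - y‖ := by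
      have := abs_real_inner_le_norm (c - y) (B ((Real.sqrt 3)⁻¹ • intVec ![1, 1, 1]))
      rwa [B.norm_map, norm_nzero, mul_one] at this
    rw [norm_sub_rev] at h2
    linarith

/-- **The core.**  In the setting of the module docstring (`4 ≤ Rp`, `19/10 ≤ D`), every centre
`x` within `19/10` of `c` lies in the lattice `AddSubgroup.closure F` and has shell exactly `F`.
[folklore] -/
theorem core_certified
    (hsep : ∀ x ∈ V, ∀ y ∈ V, x = y ∨ dist x y = 2 ∨ 2 * hales_h0 ≤ dist x y)
    (hF : IsArrangedIn F fccKissingPattern) (h0V : (0 : EuclideanSpace ℝ (Fin 3)) ∈ V)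
    (h0 : kissingShell V 0 = F) (hc : ‖c‖ ≤ Real.sqrt 2) (hRp : 4 ≤ Rp) (hD : 19 / 10 ≤ D)
    (hpat : ∀ y ∈ V, ‖y - c‖ < Rp →
      IsArrangedIn (kissingShell V y) fccKissingPattern ∨ IsArrangedIn (kissingShell V y) hcpKissingPattern)
    (hnohcp : ∀ y ∈ V, ‖y - c‖ < Rp → ∀ B : EuclideanSpace ℝ (Fin 3) →ₗᵢ[ℝ] EuclideanSpace ℝ (Fin 3),
      kissingShell V y = Set.range (fun i => B (hcpRef i)) →
      D < |⟪c - y, B ((Real.sqrt 3)⁻¹ • intVec ![1, 1, 1])⟫|)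
    {x : EuclideanSpace ℝ (Fin 3)} (hxV : x ∈ V) (hx : ‖x - c‖ ≤ 19 / 10) :
    x ∈ (AddSubgroup.closure F : AddSubgroup (EuclideanSpace ℝ (Fin 3))) ∧ kissingShell V x = F := by
  have hs2 : Real.sqrt 2 < 1.415 := by
    rw [show (1.415 : ℝ) = Real.sqrt (1.415 ^ 2) by rw [Real.sqrt_sq (by norm_num)]]
    exact Real.sqrt_lt_sqrt (by norm_num) (by norm_num)
  have hh0 : 2 * hales_h0 = 2.52 := by rw [hales_h0_eq]; norm_num
  have subF : F ⊆ (AddSubgroup.closure F : AddSubgroup (EuclideanSpace ℝ (Fin 3))) := AddSubgroup.subset_closure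
  have hxn : ‖x‖ ≤ 19 / 10 + Real.sqrt 2 := by
    calc ‖x‖ = ‖(x - c) + c‖ := by rw [sub_add_cancel]
      _ ≤ ‖x - c‖ + ‖c‖ := norm_add_le _ _
      _ ≤ 19 / 10 + Real.sqrt 2 := add_le_add hx hc
  have hxR : ‖x - c‖ < Rp := by linarith
  have hxfcc : IsArrangedIn (kissingShell V x) fccKissingPattern :=
    isArrangedIn_fcc_of_norm_sub_le hpat hnohcp hxV hxR (by linarith)
  -- the FCC step from the origin
  have step0 : ∀ {t}, t ∈ F → IsArrangedIn (kissingShell V t) fccKissingPattern → kissingShell V t = F := by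
    intro t ht hfcc
    have := kissingShell_add_eq_of_fcc (V := V) hF h0V h0 ht (by rw [zero_add]; exact hfcc)
    rwa [zero_add] at this
  rcases hsep x hxV 0 h0V with hx0 | hx0 | hx0
  · -- `x` is the origin
    subst hx0
    exact ⟨AddSubgroup.zero_mem _, h0⟩
  · -- `x` touches the origin
    have hxF : x ∈ F := by
      rw [← h0]; exact ⟨by simpa using hxV, by rwa [dist_eq_norm, sub_zero] at hx0⟩
    exact ⟨subF hxF, step0 hxF hxfcc⟩
  · -- `x` is far: a neighbour `x'` closer to the origin touches the origin
    rw [hh0, dist_eq_norm, sub_zero] at hx0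
    obtain ⟨p, hp, hle⟩ := exists_mem_kissingShell_norm_add_sub_sq_le (hpat x hxV hxR) 0
    rw [sub_zero, sub_zero] at hle
    have hx'V : x + p ∈ V := hp.1
    have hp2 : ‖p‖ = 2 := hp.2
    have hx'n : ‖x + p‖ ^ 2 < 6.35 := by
      have e : ‖x‖ ^ 2 - 2 * Real.sqrt 2 * ‖x‖ + 4 = (‖x‖ - Real.sqrt 2) ^ 2 + 2 := by
        nlinarith [Real.sq_sqrt (show (0 : ℝ) ≤ 2 by norm_num)]
      have h1 : 0 ≤ ‖x‖ - Real.sqrt 2 := by linarith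
      have h3 : ‖x‖ - Real.sqrt 2 ≤ 19 / 10 := by linarith
      have h4 : (‖x‖ - Real.sqrt 2) ^ 2 ≤ (19 / 10) ^ 2 := pow_le_pow_left₀ h1 h3 2
      linarith
    have hx'lt : ‖x + p‖ < 2.52 := by
      by_contra hge
      push Not at hge
      have : (2.52 : ℝ) ^ 2 ≤ ‖x + p‖ ^ 2 := pow_le_pow_left₀ (by norm_num) hge 2
      linarith
    -- `−p` is in the shell of `x' = x + p`, pointing back to `x = x' + (−p)`
    have hnegp : -p ∈ kissingShell V (x + p) := ⟨by simpa using hxV, by rw [norm_neg, hp2]⟩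
    have hxe : x = (x + p) + -p := by abel
    rcases hsep (x + p) hx'V 0 h0V with h' | h' | h'
    · exfalso
      have : ‖x‖ = 2 := by
        have e : x = -p := by
          calc x = (x + p) + -p := hxe
            _ = -p := by rw [h', zero_add]
        rw [e, norm_neg, hp2]
      linarith
    · have hx'F : x + p ∈ F := by
        rw [← h0]; exact ⟨by simpa using hx'V, by rwa [dist_eq_norm, sub_zero] at h'⟩
      have hx'c : ‖(x + p) - c‖ < Rp := by
        have : ‖(x + p) - c‖ ≤ ‖x + p‖ + ‖c‖ := norm_sub_le _ _
        linarith
      rcases hpat (x + p) hx'V hx'c with hf | hh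
      · -- FCC neighbour: two FCC steps
        have hS' : kissingShell V (x + p) = F := step0 hx'F hf
        have hpF : -p ∈ F := hS' ▸ hnegp
        refine ⟨?_, ?_⟩
        · rw [hxe]; exact AddSubgroup.add_mem _ (subF hx'F) (subF hpF)
        · have := kissingShell_add_eq_of_fcc hF hx'V hS' hpF (by rw [← hxe]; exact hxfcc)
          rwa [← hxe] at this
      · -- HCP neighbour: the far triple is excluded, then the square corner certifies `x`
        obtain ⟨B, hB, hlev, hfar⟩ := far_triple_of_hcp (V := V) hF h0V h0 hx'F (by rw [zero_add]; exact hh)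
        rw [zero_add] at hB hfar
        have hpF : -p ∈ F := by
          rcases hfar (-p) hnegp with h1 | h1
          · exact h1
          · exfalso
            refine far_level_excluded (by rw [B.norm_map, norm_nzero]) hlev h1 hc hD
              (hnohcp (x + p) hx'V hx'c B hB) ?_
            rw [← hxe]; exact hx
        refine ⟨?_, ?_⟩
        · rw [hxe]; exact AddSubgroup.add_mem _ (subF hx'F) (subF hpF)
        · have hlo : 6.35 ≤ ‖(x + p) + -p‖ ^ 2 := by
            rw [← hxe]; nlinarith
          have hhi : ‖(x + p) + -p‖ ^ 2 < 12 := by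
            rw [← hxe]
            have h1 : ‖x‖ < 3.32 := by linarith
            have := pow_lt_pow_left₀ h1 (norm_nonneg _) two_ne_zero
            linarith
          have horth := inner_eq_zero_of_norm_add_sq hF hx'F hpF hlo hhi
          have := kissingShell_eq_of_second_neighbour hF h0 hx'F hpF horth (by rw [← hxe]; exact hxfcc)
          rwa [← hxe] at this
    · exfalso
      rw [hh0, dist_eq_norm, sub_zero] at h'
      linarith

end Core

end Summit.AtomisticToContinuum.Crystallization.Theorems

end
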